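import Mathlib
import HarnessLib
import HarnessLib.Audit
import Summits.KontsevichZagierPeriods.Statement
import Literature.NumberTheory.Transcendental.KZProductIdeal
import Literature.NumberTheory.Transcendental.Associators
import Literature.NumberTheory.Transcendental.MZVShuffleRegularisation
import Literature.NumberTheory.Transcendental.MZVSimplexRep
import Literature.NumberTheory.Transcendental.MZVWordShuffle
import Literature.NumberTheory.Transcendental.MultipleZetaStuffle
import Literature.NumberTheory.Transcendental.MZVDualIndex
import Literature.NumberTheory.Transcendental.AyoubPeriodSeries
-- the route file itself (parent decl `SectorToKernel`) and the landed composition used by the glue proof: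
import Summits.KontsevichZagierPeriods.KontsevichZagierPeriods.Theses.FurushoPentagon
import Summits.KontsevichZagierPeriods.KontsevichZagierPeriods.Theorems.HermiteRigidityReductionRigidityOfCubes

/-!
# MOCK of the post-split route file context — `--split SectorToKernel --into CubeResolution AyoubEffectiveCubeKernel`
(planner-cstrat-stmt-KontsevichZagierPeriods-10813-r1, 2026-08-17)

Declared in the scratch namespace `…Cruxes.SectorToKernel.SplitMock` (NOT in `…Theses.FurushoPentagon`, so that this workfile never
clashes with the route file once the split is applied); `SectorToKernel` below is the ROUTE decl (opened).  What the gate will render into `Theses/FurushoPentagon.lean` after the split (imports = the route's 7 + the ONE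
new import `Literature.NumberTheory.Transcendental.AyoubPeriodSeries` needed by child 2; same `open`s as the
route file), followed by the prover's one-line closing of the generated glue item from the LANDED composition.
The children are BYTE-IDENTICAL with items stmt-17978 / stmt-18116 (route HermiteRigidity), so they dedup onto
them; the glue proof goes through because the route-local copies unfold definitionally to HermiteRigidity's decls.
-/

namespace Summit.KontsevichZagierPeriods.KontsevichZagierPeriods.Cruxes.SectorToKernel.SplitMock

open scoped BigOperators Topology Manifold Classical MeasureTheory ProbabilityTheory Matrix InnerProductSpace ComplexConjugate ContinuousMap
open Filter Set Function TopologicalSpace MeasureTheory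
open Literature Periods
open Summit.KontsevichZagierPeriods.KontsevichZagierPeriods.Theses.FurushoPentagon (SectorToKernel)

/-- child 1 (dedups onto stmt-KontsevichZagierPeriods-17978 `HermiteRigidity.CubeResolution`). -/
def CubeResolution : Prop :=
  ∀ (N : ℕ) (u : Literature.NumberTheory.Transcendental.KZ.IntegralRep N), ∃ c ∈ AddSubgroup.closure {d : Literature.NumberTheory.Transcendental.KZ.FormalRep | ∃ (n : ℕ) (r : Literature.NumberTheory.Transcendental.KZ.IntegralRep n), r.domain = {x : Fin n → ℝ | ∀ i, 0 ≤ x i ∧ x i ≤ 1} ∧ AnalyticOnNhd ℝ r.integrand {x : Fin n → ℝ | ∀ i, 0 ≤ x i ∧ x i ≤ 1} ∧ d = Literature.NumberTheory.Transcendental.KZ.of r}, Literature.NumberTheory.Transcendental.KZ.of u - c ∈ Literature.NumberTheory.Transcendental.KZ.relations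

/-- child 2 (dedups onto stmt-KontsevichZagierPeriods-18116 `HermiteRigidity.AyoubEffectiveCubeKernel`). -/
def AyoubEffectiveCubeKernel : Prop :=
  ∀ F ∈ Literature.NumberTheory.Transcendental.AyoubRel.Oan (Rat.castHom ℂ), Literature.NumberTheory.Transcendental.AyoubRel.intC F = 0 → F ∈ Literature.NumberTheory.Transcendental.AyoubRel.kSpan (Rat.castHom ℂ) {x : Literature.NumberTheory.Transcendental.AyoubRel.CSeries | ∃ G ∈ Literature.NumberTheory.Transcendental.AyoubRel.Oan (Rat.castHom ℂ), ∃ i : ℕ, x = Literature.NumberTheory.Transcendental.AyoubRel.relAC i G}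

/-- the generated glue item (`--glue … --glue-decl-name SectorToKernelOfCubes`). -/
def SectorToKernelOfCubes : Prop :=
  CubeResolution → AyoubEffectiveCubeKernel → SectorToKernel

/-- byte-identity with the hub items, checked by `Iff.rfl` (definitional unfolding both sides). -/
example : CubeResolution ↔ Summit.KontsevichZagierPeriods.KontsevichZagierPeriods.Theses.HermiteRigidity.CubeResolution := Iff.rfl
example : AyoubEffectiveCubeKernel ↔ Summit.KontsevichZagierPeriods.KontsevichZagierPeriods.Theses.HermiteRigidity.AyoubEffectiveCubeKernel := Iff.rfl

/-- THE PROVER'S ONE-LINER closing the glue item (here through the landed `kernelForm_of_cubes`; post-split the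
packaged `SectorToKernel.sectorToKernel_of_cubeResolution_of_ayoubEffectiveCubeKernel h1 h6` is the same term). -/
theorem sectorToKernelOfCubes_proof : SectorToKernelOfCubes :=
  fun h1 h6 _ _ =>
    Summit.KontsevichZagierPeriods.HermiteRigidity.ReductionRigidityOfCubes.kernelForm_of_cubes h1 h6

/-- and the derived theorem the gate renders once both children close (`SectorToKernel_holds`), as a function of
the children. -/
theorem SectorToKernel_of_children (h1 : CubeResolution) (h6 : AyoubEffectiveCubeKernel) : SectorToKernel :=
  sectorToKernelOfCubes_proof h1 h6

end Summit.KontsevichZagierPeriods.KontsevichZagierPeriods.Cruxes.SectorToKernel.SplitMock
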